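import Summits.Ventures.HSemireg.EmbeddedFirstOrderDeformationsCechMinusNCurve

/-!
# Venture HSemireg — on `𝒪_{ℙ¹}(−n)` EVERY basis class `s^{−j}`, `1 ≤ j ≤ n − 1`, of `H¹(ℙ¹, 𝒪(−n))` obstructs:
# the zero section does not lift along the twist `s^{−j}∂/∂p` (`…CechMinusNCurve` is the case `j = 1`)

HONEST FRAMING.  Lean side of the computation cell `pub-hsemireg` (track «S4-PUSH» (ii), seat s4-prove-3 g6, second
route for (S5)); log `s4push/prove-3/ATTEMPT-10.md` §5n.  The atlas of `…CechMinusNCurve` (`q = s^{m+1}p`, `n = m+1`)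
with the twist family `θ^{(j)}_αβ = (β − α)·s^{−j}∂/∂p`; the (0,1) coboundary equation becomes
`s^{m+1−j} ≡ H(s⁻¹, ·) − s^{m+1}G (mod p)`, i.e. `x^i − (H(x⁻¹) − x^n G) = 0` in `k[x]_x` with `1 ≤ i = n − j < n`,
impossible by the coefficient of `x^{i+N}` (`key_contradiction_pow₂`).  So the obstruction map of Thm. 6.2 (b)
detects every element of the standard basis `{s^{−1}, …, s^{−(n−1)}}` of `H¹(ℙ¹, 𝒪(−n))` (`h¹ = n − 1`).  Plain
commutative algebra; no Mathlib scheme, sheaf, abelian variety or semiregularity map; nothing here says that HC, HC_CM or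
HC_AV holds; no object is certified; no Literature fact is declared.

WHAT (namespace `Summit.Ventures.HSemireg.EmbeddedDeformation.DoubledLine`; parameters `m j : ℕ`): `thetaPow k j`
(the family `(β − α)·theta (s^{−j})`), `key_contradiction_pow₂` (`1 ≤ i < n`),
**`not_exists_isAtlasLift_minusN_pow`** (`1 ≤ j ≤ m`: no lift of the zero section of `𝒪_{ℙ¹}(−m−1)` along
`s^{−j}∂/∂p`).

References: R. Hartshorne, *Deformation Theory*, GTM 257 (2010), §6 Thm. 6.2 (b) [corpus:
book:springernd-deformation-theory p0054]; `H¹(ℙ¹, 𝒪(−n)) = ⟨s^{−1}, …, s^{−(n−1)}⟩` [folklore].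
-/

namespace Summit.Ventures.HSemireg

namespace EmbeddedDeformation

namespace DoubledLine

open DualNumber TrivSqZeroExt MvPolynomial

universe u

variable (k : Type u) [CommRing k] (m : ℕ)

/-- The twist family of the class `s^{−j}`: `θ^{(j)}_αβ = (β − α)·s^{−j}∂/∂p`. -/
noncomputable def thetaPow (j : ℕ) (α β : Fin 2) : DerZ (L k) :=
  (((β : ℕ) : ℤ) - ((α : ℕ) : ℤ)) • theta k (IsLocalization.Away.invSelf (X 0 : A k) ^ j)

/-- `θ^{(j)}₀₁ = s^{−j}∂/∂p`. [folklore] -/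
theorem thetaPow_zero_one (j : ℕ) : thetaPow k j 0 1 = theta k (IsLocalization.Away.invSelf (X 0 : A k) ^ j) := by
  rw [thetaPow]
  simp

/-- **Key computation (two exponents).**  In `k[x]_x` with `u·x = 1` and `1 ≤ i < n`, the identity
`x^i − (H(u) − x^n·G(x)) = 0` is impossible over a non-trivial `k`: multiply by `x^N` (`N = deg H`,
`Polynomial.reflect`) and read off the coefficient of `x^{i+N}`: `1 = 0`. [folklore] -/
theorem key_contradiction_pow₂ [Nontrivial k] (i n : ℕ) (hi : 1 ≤ i) (hin : i < n) (G H : Polynomial k)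
    {u : Localization.Away (Polynomial.X : Polynomial k)}
    (hu : u * algebraMap (Polynomial k) (Localization.Away (Polynomial.X : Polynomial k)) Polynomial.X = 1)
    (h : algebraMap (Polynomial k) (Localization.Away (Polynomial.X : Polynomial k)) Polynomial.X ^ i -
        (Polynomial.eval₂ (algebraMap k _) u H -
          algebraMap (Polynomial k) _ Polynomial.X ^ n * algebraMap (Polynomial k) _ G) = 0) : False := by
  obtain ⟨d, rfl⟩ : ∃ d, n = i + (d + 1) := ⟨n - i - 1, by omega⟩
  set x : Localization.Away (Polynomial.X : Polynomial k) :=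
    algebraMap (Polynomial k) (Localization.Away (Polynomial.X : Polynomial k)) Polynomial.X with hx
  haveI : Invertible x := ⟨u, hu, by rw [mul_comm]; exact hu⟩
  have hux : ⅟x = u := invOf_eq_left_inv hu
  have hrr : Polynomial.reflect H.natDegree (Polynomial.reflect H.natDegree H) = H :=
    Polynomial.ext fun i ↦ by rw [Polynomial.coeff_reflect, Polynomial.coeff_reflect, Polynomial.revAt_invol]
  have hdeg : (Polynomial.reflect H.natDegree H).natDegree ≤ H.natDegree :=
    Polynomial.natDegree_le_iff_coeff_eq_zero.2 fun i hi ↦ by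
      rw [Polynomial.coeff_reflect, Polynomial.revAt_eq_self_of_lt hi]
      exact Polynomial.coeff_eq_zero_of_natDegree_lt hi
  have hev : ∀ q : Polynomial k,
      Polynomial.eval₂ (algebraMap k (Localization.Away (Polynomial.X : Polynomial k))) x q =
        algebraMap (Polynomial k) (Localization.Away (Polynomial.X : Polynomial k)) q := by
    intro q
    have e : Polynomial.eval₂RingHom (algebraMap k (Localization.Away (Polynomial.X : Polynomial k))) x =
        algebraMap (Polynomial k) (Localization.Away (Polynomial.X : Polynomial k)) :=
      Polynomial.ringHom_ext (fun a ↦ by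
          rw [Polynomial.coe_eval₂RingHom, Polynomial.eval₂_C, IsScalarTower.algebraMap_apply k (Polynomial k)
            (Localization.Away (Polynomial.X : Polynomial k)) a, Polynomial.algebraMap_eq])
        (by rw [Polynomial.coe_eval₂RingHom, Polynomial.eval₂_X])
    exact DFunLike.congr_fun e q
  have h1 : Polynomial.eval₂ (algebraMap k _) u H * x ^ H.natDegree =
      algebraMap (Polynomial k) _ (Polynomial.reflect H.natDegree H) := by
    have := Polynomial.eval₂_reflect_mul_pow (algebraMap k (Localization.Away (Polynomial.X : Polynomial k))) x
      H.natDegree (Polynomial.reflect H.natDegree H) hdeg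
    rw [hrr, hux, hev] at this
    exact this
  have h2 : Polynomial.eval₂ (algebraMap k _) u H =
      x ^ i + x ^ (i + (d + 1)) * algebraMap (Polynomial k) (Localization.Away (Polynomial.X : Polynomial k)) G := by
    rw [sub_eq_zero] at h
    linear_combination -h
  have h3 : algebraMap (Polynomial k) (Localization.Away (Polynomial.X : Polynomial k))
      ((1 + Polynomial.X ^ (d + 1) * G) * Polynomial.X ^ (i + H.natDegree)) =
      algebraMap (Polynomial k) _ (Polynomial.reflect H.natDegree H) := by
    rw [← h1, h2]
    simp only [map_mul, map_add, map_pow, map_one, ← hx]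
    ring
  have hinj : Function.Injective (algebraMap (Polynomial k) (Localization.Away (Polynomial.X : Polynomial k))) :=
    IsLocalization.injective _ (Submonoid.powers_le.2 (mem_nonZeroDivisors_iff_right.2 fun q hq ↦
      (Polynomial.isRegular_X (R := k)).right (show q * Polynomial.X = 0 * Polynomial.X by rw [hq, zero_mul])))
  have h4 := congrArg (fun q : Polynomial k ↦ q.coeff (0 + (i + H.natDegree))) (hinj h3)
  rw [Polynomial.coeff_mul_X_pow, Polynomial.coeff_add, Polynomial.coeff_one_zero, Polynomial.coeff_X_pow_mul',
    if_neg (by omega), add_zero, zero_add, Polynomial.coeff_reflect, Polynomial.revAt_eq_self_of_lt (by omega),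
    Polynomial.coeff_eq_zero_of_natDegree_lt (by omega)] at h4
  exact one_ne_zero h4

/-- **EVERY CLASS `s^{−j}`, `1 ≤ j ≤ m`, OBSTRUCTS THE (−m−1)-CURVE.**  In the thickened atlas of `𝒪_{ℙ¹}(−m−1)`
(`q = s^{m+1}p`) twisted by `θ^{(j)} = s^{−j}∂/∂p`, the zero section has NO lift: the (0,1) coboundary equation at
`s^{m+1}p`, divided through, says `s^{m+1−j} ≡ H(s⁻¹, ·) − s^{m+1}G (mod p)`; under `s ↦ x, p ↦ 0` this is
`key_contradiction_pow₂` with `i = m + 1 − j`, `n = m + 1`. [cite: Hartshorne2010, §6 Thm. 6.2 (b)] -/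
theorem not_exists_isAtlasLift_minusN_pow [Nontrivial k] (j : ℕ) (hj : 1 ≤ j) (hjm : j ≤ m) :
    ¬ ∃ K : Fin 2 → Ideal (A k)[ε],
      IsAtlasLift (fun _ : Fin 2 ↦ fstRingHom (A k)) (fun _ ↦ (ε : (A k)[ε])) (fun α _ ↦ mapRingHom (resMN k m α))
        (fun α β ↦ (twist (thetaPow k j α β) : (L k)[ε] →+* (L k)[ε]).comp (mapRingHom (resMN k m β)))
        (idealZ k) K := by
  rintro hK
  have 𝔄 := thickenedAtlas_twisted (fun α _ ↦ resMN k m α) (fun _ β ↦ resMN k m β) (idealZ k) (idealZ₂ k)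
    (thetaPow k j) (preservesLifts_resMN k m) (fun α β ↦ preservesLifts_resMN k m β α)
  have hsec := isLift_map_chartSection 𝔄 (fun _ ↦ algebraMap (A k) (A k)[ε]) fun _ ↦ fstRingHom_algebraMap
  obtain ⟨φ, hφ⟩ := (exists_isAtlasLift_twisted_iff (fun α _ ↦ resMN k m α) (fun _ β ↦ resMN k m β) (idealZ k)
    (idealZ₂ k) (thetaPow k j) (preservesLifts_resMN k m) (fun α β ↦ preservesLifts_resMN k m β α)).1 hK
  -- the generator `p/1` of `I_L`, its multiple `s^{m+1}p = resMN 1 p`, representatives of `φ_α(p)`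
  have hX1 : (X 1 : A k) ∈ idealZ k 0 := Ideal.subset_span rfl
  have hX1' : (X 1 : A k) ∈ idealZ k 1 := Ideal.subset_span rfl
  have hmem : algebraMap (A k) (L k) (X 1) ∈ idealZ₂ k 0 1 := Ideal.mem_map_of_mem _ (Ideal.subset_span rfl)
  have hmem₁ : resMN k m 1 (X 1) ∈ idealZ₂ k 0 1 := by
    rw [resMN_one_X_one]
    exact Ideal.mul_mem_left _ _ hmem
  obtain ⟨y₀, hy₀⟩ := Ideal.Quotient.mk_surjective (φ 0 ⟨X 1, hX1⟩)
  obtain ⟨y₁, hy₁⟩ := Ideal.Quotient.mk_surjective (φ 1 ⟨X 1, hX1'⟩)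
  have e0 : resL 𝔄 hsec 0 1 (φ 0) ⟨algebraMap (A k) (L k) (X 1), hmem⟩ =
      Ideal.Quotient.mk (idealZ₂ k 0 1) (algebraMap (A k) (L k) y₀) :=
    resNormal_apply (𝔄.homl 0 1) (𝔄.liftsl 0 1) (hsec 0) (φ 0) ⟨X 1, hX1⟩ y₀ hy₀ hmem
  have e1 : resR 𝔄 hsec 0 1 (φ 1) ⟨resMN k m 1 (X 1), hmem₁⟩ =
      Ideal.Quotient.mk (idealZ₂ k 0 1) (resMN k m 1 y₁) :=
    resNormal_apply (𝔄.homr 0 1) (𝔄.liftsr 0 1) (hsec 1) (φ 1) ⟨X 1, hX1'⟩ y₁ hy₁ hmem₁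
  have hx1 : (⟨resMN k m 1 (X 1), hmem₁⟩ : idealZ₂ k 0 1) =
      (algebraMap (A k) (L k) (X 0) ^ (m + 1)) • (⟨algebraMap (A k) (L k) (X 1), hmem⟩ : idealZ₂ k 0 1) :=
    Subtype.ext (by
      show resMN k m 1 (X 1) = algebraMap (A k) (L k) (X 0) ^ (m + 1) • algebraMap (A k) (L k) (X 1)
      rw [resMN_one_X_one, smul_eq_mul])
  have e1' : resR 𝔄 hsec 0 1 (φ 1)
      ((algebraMap (A k) (L k) (X 0) ^ (m + 1)) • (⟨algebraMap (A k) (L k) (X 1), hmem⟩ : idealZ₂ k 0 1)) =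
        Ideal.Quotient.mk (idealZ₂ k 0 1) (resMN k m 1 y₁) := by
    rw [← hx1]
    exact e1
  -- the (0,1) coboundary equation at `s^{m+1}·(p/1)`
  have key : algebraMap (A k) (L k) (X 0) ^ (m + 1) •
      Ideal.Quotient.mk (idealZ₂ k 0 1)
        (theta k (IsLocalization.Away.invSelf (X 0 : A k) ^ j) (algebraMap (A k) (L k) (X 1))) =
      Ideal.Quotient.mk (idealZ₂ k 0 1) (resMN k m 1 y₁) -
        algebraMap (A k) (L k) (X 0) ^ (m + 1) • Ideal.Quotient.mk (idealZ₂ k 0 1) (algebraMap (A k) (L k) y₀) := by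
    have h01 := LinearMap.congr_fun (hφ 0 1)
      ((algebraMap (A k) (L k) (X 0) ^ (m + 1)) • (⟨algebraMap (A k) (L k) (X 1), hmem⟩ : idealZ₂ k 0 1))
    rw [LinearMap.sub_apply, map_smul (derivToNormal (idealZ₂ k 0 1) (thetaPow k j 0 1)),
      map_smul (resL 𝔄 hsec 0 1 (φ 0)), e1', e0, derivToNormal_apply, thetaPow_zero_one] at h01
    exact h01
  rw [theta_algebraMap_X_one] at key
  have hsm : ∀ c a : L k, c • Ideal.Quotient.mk (idealZ₂ k 0 1) a = Ideal.Quotient.mk (idealZ₂ k 0 1) (c * a) :=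
    fun _ _ ↦ rfl
  rw [hsm, hsm] at key
  have hc : algebraMap (A k) (L k) (X 0) ^ (m + 1) * IsLocalization.Away.invSelf (X 0 : A k) ^ j =
      algebraMap (A k) (L k) (X 0) ^ (m + 1 - j) := by
    obtain ⟨i, hi⟩ : ∃ i, m + 1 = i + j := ⟨m + 1 - j, by omega⟩
    rw [show m + 1 - j = i by omega, hi, pow_add, mul_assoc, ← mul_pow, IsLocalization.Away.mul_invSelf, one_pow,
      mul_one]
  rw [hc, ← map_sub, Ideal.Quotient.eq] at key
  -- `s^m − (psiN y₁ − s^{m+1} y₀) ∈ (p)·L`; map to `k[x]_x`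
  have hev := ev_eq_zero_of_mem k key
  rw [map_sub, map_sub, map_mul, map_pow, map_pow, ev_algebraMap_X_zero, ev_algebraMap_eq k y₀, resMN_one,
    RingHom.comp_apply] at hev
  change _ - (ev k (psiNHom k m (algebraMap (A k) (L k) y₁)) - _) = 0 at hev
  rw [psiNHom_algebraMap, ← RingHom.comp_apply (ev k) (psiN₀ k m), ev_comp_psiN₀, eval₂Hom_pair_zero] at hev
  -- `ev s⁻¹ · x = 1`
  have hinv : ev k (IsLocalization.Away.invSelf (X 0 : A k)) *
      algebraMap (Polynomial k) (Localization.Away (Polynomial.X : Polynomial k)) Polynomial.X = 1 := by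
    rw [← ev_algebraMap_X_zero, ← map_mul, mul_comm, IsLocalization.Away.mul_invSelf, map_one]
  exact key_contradiction_pow₂ k (m + 1 - j) (m + 1) (by omega) (by omega) _ _ hinv hev

end DoubledLine

end EmbeddedDeformation

end Summit.Ventures.HSemireg
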